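import Summits.KontsevichZagierPeriods.KontsevichZagierPeriods.Theses.TwoRouteTransport

/-!
# `Assembly` (stmt-KontsevichZagierPeriods-14634, route TwoRouteTransport) — proof

The route's assembly item
`CubicTransportStable → BetaCancellation → TransportGlue → CompleteModCubicEndpoint →
KontsevichZagierPeriods`
is its deciding theorem `closes` read as an implication. (lead c10 of crux 9129, banking)
-/

namespace Summit.KontsevichZagierPeriods.TwoRouteTransport

/-- **Assembly of route TwoRouteTransport** (stmt-KontsevichZagierPeriods-14634):
`CubicTransportStable → BetaCancellation → TransportGlue → CompleteModCubicEndpoint →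
KontsevichZagierPeriods`
— the cruxes imply the summit: `TransportGlue` turns the first two into `CubicEndpoint`, then the
route's deciding theorem `closes`.
[Kontsevich–Zagier 2001, §1.2] [folklore] -/
theorem assembly_proof :
    Summit.KontsevichZagierPeriods.KontsevichZagierPeriods.Theses.TwoRouteTransport.Assembly := by
  intro h₁ h₂ hG h₆
  exact Summit.KontsevichZagierPeriods.KontsevichZagierPeriods.Theses.TwoRouteTransport.closes
    (hG h₁ h₂) h₆

end Summit.KontsevichZagierPeriods.TwoRouteTransport
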